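import Summits.CriticalPhenomena.PercolationContinuityZ3.Theorems.PercNearOneGluingNoHeavyLowerTailStarSetForestCertificateTools
import HarnessLib

/-!
# `NoHeavyLowerTail` (stmt-CriticalPhenomena-4575) — the swap Φ of the U1′_r charging scheme lands in a credit configuration

Support file (prover `prim-gen-swap` gen 11; `--supports stmt-CriticalPhenomena-4575`).  No definitions, no named facts, no sorries.

Lemma L5.1 of the seat memo U1-PROOF.md (blueprint item B3), in the abstract configuration language of
`StarSet.supply_reduction_pointwise` / `StarSet.config_expansion_identity`: classes `ι` (linear order = leaf-peeling order), a symmetric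
adjacency `adj` ("share a port"), counted chords `Cr`, forest classes `F`, child edges `Ch ⊆ F`.  A configuration `S` (open classes) is a
CREDIT configuration iff no counted chord of `S` sees all of `S` adjacent to it (`n(S) = 0`) and either no forest class is open or the first open
forest class is a child edge (`y(S) = 1`).  THE SWAP: `K ∈ S` a counted chord adjacent to every class of `S` (an "Ω-chord"), `A ∈ Ch` a closed child
edge ("`A = {d,r}`, `d` a hot end of `K`"); the classes adjacent to `A` among counted chords are those "containing `d`" (abstract predicate `atd`);
hypotheses (Φ3) no other Ω-chord of `S` contains `d`, (Φ4) the first open forest class of `S` (if any) is a child edge or comes after `A`.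
Then `S − K + A` is a credit configuration (`StarSet.swap_mem_cred`), and its weight dominates that of `S` when `θ_A ≥ θ_K`
(`StarSet.swap_weight_ge`, division-free).
-/

namespace Summit.CriticalPhenomena.PercolationContinuityZ3.Theorems

open Finset
open scoped BigOperators

namespace StarSet

variable {ι : Type*} [Fintype ι] [LinearOrder ι]

/-- **L5.1 of U1-PROOF.md: the swapped configuration is a credit configuration.**  See the file header. -/
theorem swap_mem_cred (adj : ι → ι → Prop) [DecidableRel adj] (hsymm : ∀ a b, adj a b → adj b a)
    (Cr F Ch : Finset ι) (hCh : Ch ⊆ F) (hCF : Disjoint Cr F)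
    (S : Finset ι) (K A : ι) (hK : K ∈ Cr) (hKS : K ∈ S) (hΩ : ∀ j ∈ S, adj j K)
    (hA : A ∈ Ch) (hAS : A ∉ S)
    (atd : ι → Prop) [DecidablePred atd] (hfar : ∀ μ ∈ Cr, ¬ atd μ → ¬ adj A μ)
    (hΦ3 : ∀ μ ∈ Cr, μ ∈ S → μ ≠ K → atd μ → ∃ j ∈ S, ¬ adj j μ)
    (hΦ4 : (∀ I ∈ F, I ∈ S → A < I) ∨ (∃ a ∈ Ch, a ∈ S ∧ ∀ b ∈ F, b < a → b ∉ S)) :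
    (∀ μ ∈ Cr, ¬ (μ ∈ insert A (S.erase K) ∧ ∀ j ∈ univ.filter (fun j => ¬ adj j μ), j ∉ insert A (S.erase K))) ∧
      ((∀ I ∈ F, I ∉ insert A (S.erase K)) ∨
        (∃ a ∈ Ch, a ∈ insert A (S.erase K) ∧ ∀ b ∈ F.filter (· < a), b ∉ insert A (S.erase K))) := by
  classical
  have hAK : A ≠ K := fun h => hAS (h ▸ hKS)
  have hAF : A ∈ F := hCh hA
  refine ⟨fun μ hμ ⟨hμS', hall⟩ => ?_, Or.inr ?_⟩
  · -- no Ω-chord survives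
    have hμA : μ ≠ A := fun h => (disjoint_left.1 hCF hμ) (h ▸ hAF)
    have hμS : μ ∈ S := mem_of_mem_erase ((mem_insert.1 hμS').resolve_left hμA)
    have hμK : μ ≠ K := fun h => by
      have := (mem_insert.1 hμS').resolve_left hμA
      rw [h] at this; exact (notMem_erase K S) this
    by_cases hd : atd μ
    · obtain ⟨j, hjS, hj⟩ := hΦ3 μ hμ hμS hμK hd
      have hjK : j ≠ K := fun h => hj (h ▸ hsymm μ K (hΩ μ hμS))
      exact hall j (mem_filter.2 ⟨mem_univ _, hj⟩) (mem_insert_of_mem (mem_erase.2 ⟨hjK, hjS⟩))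
    · exact hall A (mem_filter.2 ⟨mem_univ _, hfar μ hμ hd⟩) (mem_insert_self A _)
  · -- the first open forest class is a child edge
    rcases hΦ4 with hall | ⟨a, haCh, haS, hmin⟩
    · refine ⟨A, hA, mem_insert_self A _, fun b hb hbS' => ?_⟩
      obtain ⟨hbF, hbA⟩ := mem_filter.1 hb
      rcases mem_insert.1 hbS' with rfl | hb'
      · exact lt_irrefl _ hbA
      · exact lt_asymm hbA (hall b hbF (mem_of_mem_erase hb'))
    · by_cases hlt : a < A
      · have haK : a ≠ K := fun h => (disjoint_left.1 hCF hK) (h ▸ hCh haCh)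
        refine ⟨a, haCh, mem_insert_of_mem (mem_erase.2 ⟨haK, haS⟩), fun b hb hbS' => ?_⟩
        obtain ⟨hbF, hba⟩ := mem_filter.1 hb
        rcases mem_insert.1 hbS' with rfl | hb'
        · exact lt_asymm hba hlt
        · exact hmin b hbF hba (mem_of_mem_erase hb')
      · refine ⟨A, hA, mem_insert_self A _, fun b hb hbS' => ?_⟩
        obtain ⟨hbF, hbA⟩ := mem_filter.1 hb
        rcases mem_insert.1 hbS' with rfl | hb'
        · exact lt_irrefl _ hbA
        · have hbS : b ∈ S := mem_of_mem_erase hb'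
          have hba : b < a := lt_of_lt_of_le hbA (not_lt.1 hlt)
          exact hmin b hbF hba hbS

/-- **Weight monotonicity of the swap** (division-free): `W(S−K+A) ≥ W(S)` when `θ_A ≥ θ_K`, `K ∈ S`, `A ∉ S`. -/
theorem swap_weight_ge (θ : ι → ℝ) (hθ0 : ∀ i, 0 ≤ θ i) (hθ1 : ∀ i, θ i ≤ 1) (S : Finset ι) (K A : ι)
    (hKS : K ∈ S) (hAS : A ∉ S) (hdom : θ K ≤ θ A) :
    (∏ k ∈ S, θ k) * ∏ k ∈ univ \ S, (1 - θ k) ≤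
      (∏ k ∈ insert A (S.erase K), θ k) * ∏ k ∈ univ \ insert A (S.erase K), (1 - θ k) := by
  classical
  set R := S.erase K with hR
  have hS : S = insert K R := by rw [hR, insert_erase hKS]
  have hKR : K ∉ R := notMem_erase K S
  have hAR : A ∉ R := fun h => hAS (mem_of_mem_erase h)
  set G := (∏ k ∈ R, θ k) * ∏ k ∈ univ \ R, (1 - θ k) with hG
  have hGnn : 0 ≤ G := mul_nonneg (prod_nonneg fun i _ => hθ0 i) (prod_nonneg fun i _ => sub_nonneg.2 (hθ1 i))
  -- `W(insert x R)·(1 − θ_x) = θ_x·G` for `x ∉ R`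
  have hins : ∀ x, x ∉ R → ((∏ k ∈ insert x R, θ k) * ∏ k ∈ univ \ insert x R, (1 - θ k)) * (1 - θ x) = θ x * G := by
    intro x hx
    have hxm : x ∈ univ \ R := mem_sdiff.2 ⟨mem_univ _, hx⟩
    have hset : (univ \ R).erase x = univ \ insert x R := by
      ext y; simp only [mem_erase, mem_sdiff, mem_univ, true_and, mem_insert, not_or]
    rw [prod_insert hx, hG, ← mul_prod_erase (univ \ R) (fun k => 1 - θ k) hxm, hset]
    ring
  have hWS : ((∏ k ∈ S, θ k) * ∏ k ∈ univ \ S, (1 - θ k)) * (1 - θ K) = θ K * G := by rw [hS]; exact hins K hKR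
  have hWS' : ((∏ k ∈ insert A R, θ k) * ∏ k ∈ univ \ insert A R, (1 - θ k)) * (1 - θ A) = θ A * G := hins A hAR
  have hW'nn : 0 ≤ (∏ k ∈ insert A R, θ k) * ∏ k ∈ univ \ insert A R, (1 - θ k) :=
    mul_nonneg (prod_nonneg fun i _ => hθ0 i) (prod_nonneg fun i _ => sub_nonneg.2 (hθ1 i))
  by_cases hA1 : θ A = 1
  · -- then `W(S) = 0` because `A ∉ S` contributes the factor `1 − θ_A = 0`
    have hzero : ∏ k ∈ univ \ S, (1 - θ k) = 0 :=
      prod_eq_zero (mem_sdiff.2 ⟨mem_univ _, hAS⟩) (by rw [hA1]; ring)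
    rw [hzero, mul_zero]; exact hW'nn
  · have hA1' : 0 < 1 - θ A := sub_pos.2 (lt_of_le_of_ne (hθ1 A) hA1)
    have hK1' : 0 < 1 - θ K := by linarith
    -- compare `W(S)(1−θ_K)(1−θ_A) = θ_K(1−θ_A)G ≤ θ_A(1−θ_K)G = W(S')(1−θ_A)(1−θ_K)`
    have hkey : θ K * (1 - θ A) ≤ θ A * (1 - θ K) := by nlinarith [hθ0 K, hθ1 A]
    have h1 : ((∏ k ∈ S, θ k) * ∏ k ∈ univ \ S, (1 - θ k)) * ((1 - θ K) * (1 - θ A)) = θ K * (1 - θ A) * G := by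
      rw [← mul_assoc, hWS]; ring
    have h2 : ((∏ k ∈ insert A R, θ k) * ∏ k ∈ univ \ insert A R, (1 - θ k)) * ((1 - θ K) * (1 - θ A)) = θ A * (1 - θ K) * G := by
      rw [mul_comm (1 - θ K), ← mul_assoc, hWS']; ring
    have hpos : 0 < (1 - θ K) * (1 - θ A) := mul_pos hK1' hA1'
    have := mul_le_mul_of_nonneg_right hkey hGnn
    rw [← h1, ← h2] at this
    exact le_of_mul_le_mul_right this hpos

end StarSet

end Summit.CriticalPhenomena.PercolationContinuityZ3.Theorems
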